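import Literature.Analysis.ValidatedNumerics.TaylorModelIntegralCert3DVertex
import HarnessLib

/-!
# Duffy's transformation for edge (line) singularities of triple integrals, with kernel-checked certificates

Trunk T-ANA (Analysis/ValidatedNumerics); namespace `Literature.Analysis.ValidatedNumerics.PolyMP`.
Sequel of `TaylorModelIntegralCert2DVertex.lean` (Duffy's maps `duffyL` / `duffyU` of a rectangle onto its two
triangles with common vertex `(x0, y0)`, Jacobians `κ (x − x0)` and `−κ' (y − y0)`, `duffy_split`), of
`TaylorModelIntegralCert3DWeighted.lean` (the face-weighted 3-D kd-tree certificate `leafCheckWL3` / `treeCheckWL3` /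
`integral_bounds_of_leafCheckWL3` for `∫∫∫ Π_faces d^α (−log d)^κ · F`) and of `TaylorModelIntegralCert3DVertex.lean`
(vertex singularities of triple integrals: three pyramids).

Duffy, *Quadrature over a pyramid or cube of integrands with a singularity at a vertex*, SIAM J. Numer. Anal. 19
(1982) 1260–1262, removes a point singularity by dividing the domain into simplices/pyramids with the singular point
at the apex and mapping each onto a cube (`x = u`, `y = u v`, Jacobian `u` in the plane); Mousavi–Sukumar, Comput.
Mech. 45 (2010) 127–140, Sect. 1 and Appendix A (generalized Duffy transformation, the Jacobian cancelling the
singular factor); Davis–Rabinowitz, *Methods of Numerical Integration*, 2nd ed. (1984): Sect. 5.4 (change of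
variables in multiple integrals, in particular nonsingular affine maps (5.4.7)), Sect. 5.3 (change of order of
integration), Sect. 5.6 (product regions and product rules), Sect. 5.8 (compound rules: subdividing the hypercube
into smaller boxes; integrands singular at a vertex, Duffy's transformation among the devices).

An integrand of a triple integral over a box `R = [x0, x1] × [y0, y1] × [z0, z1]` which is singular along the EDGE
`{y = y0, z = z0}` (a line parallel to the `x`-axis, e.g. `((y − y0)² + (z − z0)²)^{−σ/2}` or `(y + z − y0 − z0)^{−σ}`
with `σ < 2`, times factors regular or face-singular) has, in every transverse plane `x = const`, a POINT
singularity at the vertex `(y0, z0)` of the rectangle `[y0, y1] × [z0, z1]`.  This module formalises the natural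
reduction — Duffy's two planar maps in the transverse variables `(y, z)`, the identity in the edge variable `x`
(the maps `duffyEL = id × duffyL`, `duffyEU = id × duffyU`, Jacobians `κ (y − y0)` and `−κ' (z − z0)`) — and composes
it with the face-weighted certificate: the transverse Jacobian turns the line singularity `ρ^{−σ}` into the FACE
weight `(y − y0)^{1−σ}` (resp. `(z − z0)^{1−σ}`) of the parameter box, which the weighted certificate integrates in
closed form, leaving a code list regular on the closed parameter box.

* Part A — the maps `duffyEL κ y0 z0 (x, y, t) = (x, y, z0 + κ (y − y0) t)` onto the lower transverse prism
  `{x0 ≤ x ≤ x1, y0 < y ≤ y1, z0 ≤ z ≤ z0 + κ (y − y0)}` and `duffyEU κ' y0 z0 (x, z, t) = (x, y0 + κ' (z − z0) t, z)`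
  onto the upper one (slopes `κ (y1 − y0) = z1 − z0`, `κ' (z1 − z0) = y1 − y0`): derivatives (`id × fderivDuffyL`),
  determinants, injectivity, images, the set-integral identities `setIntegral_duffyEL/EU` (Mathlib's change of
  variables, closed parameter boxes up to null sets) and the decomposition `duffyE_split`:
  `∫_R f = ∫_{[x0,x1]×[y0,y1]×[0,1]} κ (y − y0) f(x, y, z0 + κ (y − y0) t) + ∫_{[x0,x1]×[z0,z1]×[0,1]} κ' (z − z0)
  f(x, y0 + κ' (z − z0) t, z)` with the transfer of integrability — NO hypothesis on `f` beyond integrability of the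
  two transformed integrands on their closed parameter boxes (the two prisms tile the box up to the null segment
  `[x0, x1] × {(y0, z0)}`).
* Part B — the certificate `integral_bounds_of_duffyECheckWL3`: if the two transformed integrands agree on the OPEN
  parameter boxes with face-weighted code-list integrands `wfunL3 ω₁ ⟨x0, x1, y0, y1, 0, 1⟩ F₁`,
  `wfunL3 ω₂ ⟨x0, x1, z0, z1, 0, 1⟩ F₂` whose kd-tree certificates check (`decide`), then `f` is integrable on `R` and
  `lo₁ + lo₂ ≤ ∫_{x0}^{x1} ∫_{y0}^{y1} ∫_{z0}^{z1} f ≤ hi₁ + hi₂`.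
* Part C — orientation: coordinate permutations of a box as measure-preserving equivalences (change of order of
  integration, `integral3_order_zxy` / `integral3_order_yzx` with the transfer of integrability) and the corollaries
  `integral_bounds_of_duffyECheckWL3_yEdge` (edge `{x = x0, z = z0}`) and `integral_bounds_of_duffyECheckWL3_zEdge`
  (edge `{x = x0, y = y0}`).
* Part D — reflections `x ↦ x0 + x1 − x` (etc.) of the box (`integral3_reflect_x/y/z`: the iterated integral is
  unchanged and integrability on the box transfers), so that an edge through ANY two faces, and — for the vertex
  module — any vertex, reduces to the normal forms; and splitting of a box at a rational abscissa
  (`integral3_split_x/y/z`: integrability on the two halves gives integrability on the box and additivity of the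
  iterated integral), so that a singular line through the INTERIOR of a face, or through the interior of the box,
  reduces to at most four edge problems.

Deliberately NOT here: curved singular lines, logarithmic line factors `log ρ` (they need the `(−log d)^κ` face
weights after a further splitting), dimension `≥ 4`.  Problem-independent; no facts, no axioms; all certificate data
computable over `ℚ` and `ℤ`.

References: [cite: Duffy1982, p. 1260]; [cite: MousaviSukumar2009, Sect. 1 and Appendix A];
[cite: DavisRabinowitz1984, Sect. 5.4]; [cite: DavisRabinowitz1984, Sect. 5.3]; [cite: DavisRabinowitz1984, Sect. 5.6];
[cite: DavisRabinowitz1984, Sect. 5.8]; [cite: DavisRabinowitz1984, Sect. 2.12.5]; [cite: MakinoBerz2003, Algorithm 2];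
[cite: MahboubiMelquiondSibutpinote2016, Sect. 3.3].
-/

open MeasureTheory intervalIntegral Set
open scoped Interval

namespace Literature.Analysis.ValidatedNumerics

namespace PolyMP

open Literature.Analysis.ValidatedNumerics.NumericsMP
open Literature.Analysis.ValidatedNumerics.ExpPoly (Poly)
open Literature.Analysis.ValidatedNumerics.ExpPoly
open Literature.Analysis.ValidatedNumerics.TaylorForm

/-! ### Part A. Duffy's transverse maps of a box onto its two prisms, as identities of set integrals -/

/-- [folklore] Lebesgue measure on `ℝ × ℝ × ℝ` is an additive Haar measure (instance path through the iterated
product). -/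
private instance volume_prod3_isAddHaar : (volume : Measure (ℝ × ℝ × ℝ)).IsAddHaarMeasure := by
  rw [Measure.volume_eq_prod]; infer_instance

/-- **Duffy's map onto the lower transverse prism** of the box whose integrand is singular along the edge
`{y = y0, z = z0}` (parallel to the `x`-axis): the identity in the edge variable times the planar lower-triangle
map in the transverse variables, `(x, y, t) ↦ (x, y, z0 + κ (y − y0) t)` (op. cit.: `x = u`, `y = u v` in the
plane of the singular vertex, translated and scaled). [cite: Duffy1982, p. 1260] [cite: MousaviSukumar2009, Appendix A] -/
def duffyEL (κ y0 z0 : ℝ) : ℝ × ℝ × ℝ → ℝ × ℝ × ℝ := Prod.map id (duffyL κ y0 z0)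

/-- **Duffy's map onto the upper transverse prism**: `(x, z, t) ↦ (x, y0 + κ' (z − z0) t, z)` (the outer transverse
variable is `z`). [cite: Duffy1982, p. 1260] [cite: MousaviSukumar2009, Appendix A] -/
def duffyEU (κ' y0 z0 : ℝ) : ℝ × ℝ × ℝ → ℝ × ℝ × ℝ := Prod.map id (duffyU κ' y0 z0)

/-- [cite: Duffy1982, p. 1260] -/
@[simp] theorem duffyEL_apply (κ y0 z0 : ℝ) (p : ℝ × ℝ × ℝ) :
    duffyEL κ y0 z0 p = (p.1, p.2.1, z0 + κ * (p.2.1 - y0) * p.2.2) := by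
  obtain ⟨x, y, t⟩ := p; rfl

/-- [cite: Duffy1982, p. 1260] -/
@[simp] theorem duffyEU_apply (κ' y0 z0 : ℝ) (p : ℝ × ℝ × ℝ) :
    duffyEU κ' y0 z0 p = (p.1, y0 + κ' * (p.2.1 - z0) * p.2.2, p.2.1) := by
  obtain ⟨x, z, t⟩ := p; rfl

/-- The derivative of the lower prism map is `id × fderivDuffyL`. [cite: MousaviSukumar2009, Appendix A] -/
theorem hasFDerivAt_duffyEL (κ y0 z0 : ℝ) (p : ℝ × ℝ × ℝ) :
    HasFDerivAt (duffyEL κ y0 z0) ((ContinuousLinearMap.id ℝ ℝ).prodMap (fderivDuffyL κ y0 p.2)) p :=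
  (hasFDerivAt_id (𝕜 := ℝ) p.1).prodMap p (hasFDerivAt_duffyL κ y0 z0 p.2)

/-- The derivative of the upper prism map is `id × fderivDuffyU`. [cite: MousaviSukumar2009, Appendix A] -/
theorem hasFDerivAt_duffyEU (κ' y0 z0 : ℝ) (p : ℝ × ℝ × ℝ) :
    HasFDerivAt (duffyEU κ' y0 z0) ((ContinuousLinearMap.id ℝ ℝ).prodMap (fderivDuffyU κ' z0 p.2)) p :=
  (hasFDerivAt_id (𝕜 := ℝ) p.1).prodMap p (hasFDerivAt_duffyU κ' y0 z0 p.2)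

/-- The Jacobian determinant of the lower prism map: `κ (y − y0)` (the planar Jacobian `u`, op. cit.).
[cite: MousaviSukumar2009, Appendix A] -/
theorem det_fderivDuffyEL (κ y0 : ℝ) (q : ℝ × ℝ) :
    ((ContinuousLinearMap.id ℝ ℝ).prodMap (fderivDuffyL κ y0 q)).det = κ * (q.1 - y0) := by
  rw [← det_fderivDuffyL κ y0 q]
  simp only [ContinuousLinearMap.det, ContinuousLinearMap.coe_prodMap, LinearMap.det_prodMap,
    ContinuousLinearMap.coe_id, LinearMap.det_id, one_mul]

/-- The Jacobian determinant of the upper prism map: `−κ' (z − z0)`. [cite: MousaviSukumar2009, Appendix A] -/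
theorem det_fderivDuffyEU (κ' z0 : ℝ) (q : ℝ × ℝ) :
    ((ContinuousLinearMap.id ℝ ℝ).prodMap (fderivDuffyU κ' z0 q)).det = -(κ' * (q.1 - z0)) := by
  rw [← det_fderivDuffyU κ' z0 q]
  simp only [ContinuousLinearMap.det, ContinuousLinearMap.coe_prodMap, LinearMap.det_prodMap,
    ContinuousLinearMap.coe_id, LinearMap.det_id, one_mul]

/-- The lower prism map is injective off the face `y = y0` (`κ > 0`). [cite: Duffy1982, p. 1260] -/
theorem injOn_duffyEL {κ : ℝ} (hκ : 0 < κ) (y0 z0 : ℝ) (u t : Set ℝ) :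
    InjOn (duffyEL κ y0 z0) (u ×ˢ (Ioi y0 ×ˢ t)) := by
  intro p hp q hq hpq
  have h1 := congrArg Prod.fst hpq
  have h2 := congrArg Prod.snd hpq
  simp only [duffyEL, Prod.map_fst, Prod.map_snd, id_eq] at h1 h2
  exact Prod.ext h1 (injOn_duffyL hκ y0 z0 t hp.2 hq.2 h2)

/-- The upper prism map is injective off the face `z = z0` (`κ' > 0`). [cite: Duffy1982, p. 1260] -/
theorem injOn_duffyEU {κ' : ℝ} (hκ : 0 < κ') (y0 z0 : ℝ) (u t : Set ℝ) :
    InjOn (duffyEU κ' y0 z0) (u ×ˢ (Ioi z0 ×ˢ t)) := by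
  intro p hp q hq hpq
  have h1 := congrArg Prod.fst hpq
  have h2 := congrArg Prod.snd hpq
  simp only [duffyEU, Prod.map_fst, Prod.map_snd, id_eq] at h1 h2
  exact Prod.ext h1 (injOn_duffyU hκ y0 z0 t hp.2 hq.2 h2)

/-- **The image of the lower prism map** on `[x0, x1] × (y0, y1] × [0, 1]` is the lower transverse prism
`[x0, x1] × {y0 < y ≤ y1, z0 ≤ z ≤ z0 + κ (y − y0)}`. [cite: Duffy1982, p. 1260] -/
theorem image_duffyEL {κ : ℝ} (hκ : 0 < κ) (x0 x1 y0 y1 z0 : ℝ) :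
    duffyEL κ y0 z0 '' (Icc x0 x1 ×ˢ (Ioc y0 y1 ×ˢ Icc 0 1)) =
      Icc x0 x1 ×ˢ {q : ℝ × ℝ | y0 < q.1 ∧ q.1 ≤ y1 ∧ z0 ≤ q.2 ∧ q.2 ≤ z0 + κ * (q.1 - y0)} := by
  rw [duffyEL, Set.prodMap_image_prod, Set.image_id, image_duffyL hκ y0 y1 z0]

/-- **The image of the upper prism map** on `[x0, x1] × (z0, z1] × [0, 1)` is the upper transverse prism
`[x0, x1] × {z0 < z ≤ z1, y0 ≤ y < y0 + κ' (z − z0)}`. [cite: Duffy1982, p. 1260] -/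
theorem image_duffyEU {κ' : ℝ} (hκ : 0 < κ') (x0 x1 y0 z0 z1 : ℝ) :
    duffyEU κ' y0 z0 '' (Icc x0 x1 ×ˢ (Ioc z0 z1 ×ˢ Ico 0 1)) =
      Icc x0 x1 ×ˢ {q : ℝ × ℝ | z0 < q.2 ∧ q.2 ≤ z1 ∧ y0 ≤ q.1 ∧ q.1 < y0 + κ' * (q.2 - z0)} := by
  rw [duffyEU, Set.prodMap_image_prod, Set.image_id, image_duffyU hκ y0 z0 z1]

/-- [folklore] -/
private theorem Icc_prod_Ioc_prod_Icc_ae_eq3 (a b c d e g : ℝ) :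
    (Icc a b ×ˢ (Ioc c d ×ˢ Icc e g) : Set (ℝ × ℝ × ℝ)) =ᵐ[volume]
      (Icc a b ×ˢ (Icc c d ×ˢ Icc e g) : Set (ℝ × ℝ × ℝ)) := by
  rw [Measure.volume_eq_prod]
  refine Measure.set_prod_ae_eq (Filter.EventuallyEq.refl _ _) ?_
  rw [Measure.volume_eq_prod]
  exact Measure.set_prod_ae_eq Ioc_ae_eq_Icc (Filter.EventuallyEq.refl _ _)

/-- [folklore] -/
private theorem Icc_prod_Ioc_prod_Ico_ae_eq3 (a b c d e g : ℝ) :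
    (Icc a b ×ˢ (Ioc c d ×ˢ Ico e g) : Set (ℝ × ℝ × ℝ)) =ᵐ[volume]
      (Icc a b ×ˢ (Icc c d ×ˢ Icc e g) : Set (ℝ × ℝ × ℝ)) := by
  rw [Measure.volume_eq_prod]
  refine Measure.set_prod_ae_eq (Filter.EventuallyEq.refl _ _) ?_
  rw [Measure.volume_eq_prod]
  exact Measure.set_prod_ae_eq Ioc_ae_eq_Icc Ico_ae_eq_Icc

/-- **Duffy's substitution on the lower transverse prism** (no hypothesis on `f`):
`∫_{P_L} f = ∫_{[x0,x1]×[y0,y1]×[0,1]} κ (y − y0) · f(x, y, z0 + κ (y − y0) t)` and `f` is integrable on `P_L` iff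
the transformed integrand is integrable on the closed parameter box.
[cite: Duffy1982, p. 1260] [cite: MousaviSukumar2009, Appendix A] [cite: DavisRabinowitz1984, Sect. 5.4] -/
theorem setIntegral_duffyEL {κ : ℝ} (hκ : 0 < κ) (x0 x1 y0 y1 z0 : ℝ) (f : ℝ × ℝ × ℝ → ℝ) :
    (∫ p in Icc x0 x1 ×ˢ {q : ℝ × ℝ | y0 < q.1 ∧ q.1 ≤ y1 ∧ z0 ≤ q.2 ∧ q.2 ≤ z0 + κ * (q.1 - y0)}, f p =
        ∫ p in Icc x0 x1 ×ˢ (Icc y0 y1 ×ˢ Icc (0 : ℝ) 1),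
          κ * (p.2.1 - y0) * f (p.1, p.2.1, z0 + κ * (p.2.1 - y0) * p.2.2)) ∧
      (IntegrableOn f (Icc x0 x1 ×ˢ {q : ℝ × ℝ | y0 < q.1 ∧ q.1 ≤ y1 ∧ z0 ≤ q.2 ∧ q.2 ≤ z0 + κ * (q.1 - y0)})
          volume ↔
        IntegrableOn (fun p : ℝ × ℝ × ℝ => κ * (p.2.1 - y0) * f (p.1, p.2.1, z0 + κ * (p.2.1 - y0) * p.2.2))
          (Icc x0 x1 ×ˢ (Icc y0 y1 ×ˢ Icc (0 : ℝ) 1)) volume) := by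
  have hs : MeasurableSet (Icc x0 x1 ×ˢ (Ioc y0 y1 ×ˢ Icc (0 : ℝ) 1) : Set (ℝ × ℝ × ℝ)) :=
    measurableSet_Icc.prod (measurableSet_Ioc.prod measurableSet_Icc)
  have hf' : ∀ p ∈ (Icc x0 x1 ×ˢ (Ioc y0 y1 ×ˢ Icc (0 : ℝ) 1) : Set (ℝ × ℝ × ℝ)),
      HasFDerivWithinAt (duffyEL κ y0 z0) ((ContinuousLinearMap.id ℝ ℝ).prodMap (fderivDuffyL κ y0 p.2))
        (Icc x0 x1 ×ˢ (Ioc y0 y1 ×ˢ Icc (0 : ℝ) 1)) p :=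
    fun p _ => (hasFDerivAt_duffyEL κ y0 z0 p).hasFDerivWithinAt
  have hinj : InjOn (duffyEL κ y0 z0) (Icc x0 x1 ×ˢ (Ioc y0 y1 ×ˢ Icc (0 : ℝ) 1)) :=
    (injOn_duffyEL hκ y0 z0 (Icc x0 x1) (Icc 0 1)).mono
      (prod_mono Subset.rfl (prod_mono Ioc_subset_Ioi_self Subset.rfl))
  have heqOn : EqOn
      (fun p : ℝ × ℝ × ℝ => |((ContinuousLinearMap.id ℝ ℝ).prodMap (fderivDuffyL κ y0 p.2)).det| •
        f (duffyEL κ y0 z0 p))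
      (fun p : ℝ × ℝ × ℝ => κ * (p.2.1 - y0) * f (p.1, p.2.1, z0 + κ * (p.2.1 - y0) * p.2.2))
      (Icc x0 x1 ×ˢ (Ioc y0 y1 ×ˢ Icc (0 : ℝ) 1)) := by
    intro p hp
    rw [Set.mem_prod, Set.mem_prod, Set.mem_Ioc] at hp
    simp only [det_fderivDuffyEL, smul_eq_mul, duffyEL_apply]
    rw [abs_of_nonneg (mul_nonneg hκ.le (sub_nonneg.2 hp.2.1.1.le))]
  rw [← image_duffyEL hκ x0 x1 y0 y1 z0]
  constructor
  · rw [integral_image_eq_integral_abs_det_fderiv_smul volume hs hf' hinj f, setIntegral_congr_fun hs heqOn,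
      setIntegral_congr_set (Icc_prod_Ioc_prod_Icc_ae_eq3 x0 x1 y0 y1 0 1)]
  · rw [integrableOn_image_iff_integrableOn_abs_det_fderiv_smul volume hs hf' hinj f,
      integrableOn_congr_fun heqOn hs]
    exact ⟨fun h => h.congr_set_ae (Icc_prod_Ioc_prod_Icc_ae_eq3 x0 x1 y0 y1 0 1).symm,
      fun h => h.congr_set_ae (Icc_prod_Ioc_prod_Icc_ae_eq3 x0 x1 y0 y1 0 1)⟩

/-- **Duffy's substitution on the upper transverse prism** (no hypothesis on `f`):
`∫_{P_U} f = ∫_{[x0,x1]×[z0,z1]×[0,1]} κ' (z − z0) · f(x, y0 + κ' (z − z0) t, z)`, with the transfer of integrability.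
[cite: Duffy1982, p. 1260] [cite: MousaviSukumar2009, Appendix A] [cite: DavisRabinowitz1984, Sect. 5.4] -/
theorem setIntegral_duffyEU {κ' : ℝ} (hκ : 0 < κ') (x0 x1 y0 z0 z1 : ℝ) (f : ℝ × ℝ × ℝ → ℝ) :
    (∫ p in Icc x0 x1 ×ˢ {q : ℝ × ℝ | z0 < q.2 ∧ q.2 ≤ z1 ∧ y0 ≤ q.1 ∧ q.1 < y0 + κ' * (q.2 - z0)}, f p =
        ∫ p in Icc x0 x1 ×ˢ (Icc z0 z1 ×ˢ Icc (0 : ℝ) 1),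
          κ' * (p.2.1 - z0) * f (p.1, y0 + κ' * (p.2.1 - z0) * p.2.2, p.2.1)) ∧
      (IntegrableOn f (Icc x0 x1 ×ˢ {q : ℝ × ℝ | z0 < q.2 ∧ q.2 ≤ z1 ∧ y0 ≤ q.1 ∧ q.1 < y0 + κ' * (q.2 - z0)})
          volume ↔
        IntegrableOn (fun p : ℝ × ℝ × ℝ => κ' * (p.2.1 - z0) * f (p.1, y0 + κ' * (p.2.1 - z0) * p.2.2, p.2.1))
          (Icc x0 x1 ×ˢ (Icc z0 z1 ×ˢ Icc (0 : ℝ) 1)) volume) := by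
  have hs : MeasurableSet (Icc x0 x1 ×ˢ (Ioc z0 z1 ×ˢ Ico (0 : ℝ) 1) : Set (ℝ × ℝ × ℝ)) :=
    measurableSet_Icc.prod (measurableSet_Ioc.prod measurableSet_Ico)
  have hf' : ∀ p ∈ (Icc x0 x1 ×ˢ (Ioc z0 z1 ×ˢ Ico (0 : ℝ) 1) : Set (ℝ × ℝ × ℝ)),
      HasFDerivWithinAt (duffyEU κ' y0 z0) ((ContinuousLinearMap.id ℝ ℝ).prodMap (fderivDuffyU κ' z0 p.2))
        (Icc x0 x1 ×ˢ (Ioc z0 z1 ×ˢ Ico (0 : ℝ) 1)) p :=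
    fun p _ => (hasFDerivAt_duffyEU κ' y0 z0 p).hasFDerivWithinAt
  have hinj : InjOn (duffyEU κ' y0 z0) (Icc x0 x1 ×ˢ (Ioc z0 z1 ×ˢ Ico (0 : ℝ) 1)) :=
    (injOn_duffyEU hκ y0 z0 (Icc x0 x1) (Ico 0 1)).mono
      (prod_mono Subset.rfl (prod_mono Ioc_subset_Ioi_self Subset.rfl))
  have heqOn : EqOn
      (fun p : ℝ × ℝ × ℝ => |((ContinuousLinearMap.id ℝ ℝ).prodMap (fderivDuffyU κ' z0 p.2)).det| •
        f (duffyEU κ' y0 z0 p))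
      (fun p : ℝ × ℝ × ℝ => κ' * (p.2.1 - z0) * f (p.1, y0 + κ' * (p.2.1 - z0) * p.2.2, p.2.1))
      (Icc x0 x1 ×ˢ (Ioc z0 z1 ×ˢ Ico (0 : ℝ) 1)) := by
    intro p hp
    rw [Set.mem_prod, Set.mem_prod, Set.mem_Ioc] at hp
    simp only [det_fderivDuffyEU, smul_eq_mul, duffyEU_apply, abs_neg]
    rw [abs_of_nonneg (mul_nonneg hκ.le (sub_nonneg.2 hp.2.1.1.le))]
  rw [← image_duffyEU hκ x0 x1 y0 z0 z1]
  constructor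
  · rw [integral_image_eq_integral_abs_det_fderiv_smul volume hs hf' hinj f, setIntegral_congr_fun hs heqOn,
      setIntegral_congr_set (Icc_prod_Ioc_prod_Ico_ae_eq3 x0 x1 z0 z1 0 1)]
  · rw [integrableOn_image_iff_integrableOn_abs_det_fderiv_smul volume hs hf' hinj f,
      integrableOn_congr_fun heqOn hs]
    exact ⟨fun h => h.congr_set_ae (Icc_prod_Ioc_prod_Ico_ae_eq3 x0 x1 z0 z1 0 1).symm,
      fun h => h.congr_set_ae (Icc_prod_Ioc_prod_Ico_ae_eq3 x0 x1 z0 z1 0 1)⟩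

/-- [folklore] The two transverse triangles with common vertex `(y0, z0)`: disjoint, the upper one measurable,
contained in the rectangle, and covering it up to the vertex. -/
private theorem transverse_triangles {y0 y1 z0 z1 κ κ' : ℝ} (hy : y0 < y1) (hz : z0 < z1)
    (hκ : κ * (y1 - y0) = z1 - z0) (hκ' : κ' * (z1 - z0) = y1 - y0) :
    0 < κ ∧ 0 < κ' ∧
    Disjoint {q : ℝ × ℝ | y0 < q.1 ∧ q.1 ≤ y1 ∧ z0 ≤ q.2 ∧ q.2 ≤ z0 + κ * (q.1 - y0)}
      {q : ℝ × ℝ | z0 < q.2 ∧ q.2 ≤ z1 ∧ y0 ≤ q.1 ∧ q.1 < y0 + κ' * (q.2 - z0)} ∧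
    MeasurableSet {q : ℝ × ℝ | z0 < q.2 ∧ q.2 ≤ z1 ∧ y0 ≤ q.1 ∧ q.1 < y0 + κ' * (q.2 - z0)} ∧
    ({q : ℝ × ℝ | y0 < q.1 ∧ q.1 ≤ y1 ∧ z0 ≤ q.2 ∧ q.2 ≤ z0 + κ * (q.1 - y0)} ∪
        {q : ℝ × ℝ | z0 < q.2 ∧ q.2 ≤ z1 ∧ y0 ≤ q.1 ∧ q.1 < y0 + κ' * (q.2 - z0)} ⊆ Icc y0 y1 ×ˢ Icc z0 z1) ∧
    (Icc y0 y1 ×ˢ Icc z0 z1 \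
        ({q : ℝ × ℝ | y0 < q.1 ∧ q.1 ≤ y1 ∧ z0 ≤ q.2 ∧ q.2 ≤ z0 + κ * (q.1 - y0)} ∪
          {q : ℝ × ℝ | z0 < q.2 ∧ q.2 ≤ z1 ∧ y0 ≤ q.1 ∧ q.1 < y0 + κ' * (q.2 - z0)}) ⊆ {(y0, z0)}) := by
  have hκ0 : 0 < κ := by
    by_contra h
    have h' := not_lt.1 h
    nlinarith [sub_pos.2 hy, sub_pos.2 hz]
  have hκ'0 : 0 < κ' := by
    by_contra h
    have h' := not_lt.1 h
    nlinarith [sub_pos.2 hy, sub_pos.2 hz]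
  have hκκ : κ' * κ = 1 := by
    have h3 : κ' * κ * (y1 - y0) = 1 * (y1 - y0) := by rw [mul_assoc, hκ, hκ', one_mul]
    exact mul_right_cancel₀ (sub_pos.2 hy).ne' h3
  refine ⟨hκ0, hκ'0, ?_, ?_, ?_, ?_⟩
  · refine Set.disjoint_left.2 fun p hL hU => ?_
    rw [Set.mem_setOf_eq] at hL hU
    have key : κ' * (κ * (p.1 - y0)) = p.1 - y0 := by rw [← mul_assoc, hκκ, one_mul]
    have h4 : κ' * (p.2 - z0) ≤ κ' * (κ * (p.1 - y0)) :=
      mul_le_mul_of_nonneg_left (by linarith [hL.2.2.2]) hκ'0.le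
    rw [key] at h4
    linarith [hU.2.2.2]
  · have e : {q : ℝ × ℝ | z0 < q.2 ∧ q.2 ≤ z1 ∧ y0 ≤ q.1 ∧ q.1 < y0 + κ' * (q.2 - z0)} =
        ({p : ℝ × ℝ | z0 < p.2} ∩ {p : ℝ × ℝ | p.2 ≤ z1}) ∩
          ({p : ℝ × ℝ | y0 ≤ p.1} ∩ {p : ℝ × ℝ | p.1 < y0 + κ' * (p.2 - z0)}) := by
      ext p
      simp only [Set.mem_setOf_eq, Set.mem_inter_iff]
      tauto
    rw [e]
    exact ((measurableSet_lt measurable_const measurable_snd).inter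
      (measurableSet_le measurable_snd measurable_const)).inter
      ((measurableSet_le measurable_const measurable_fst).inter
        (measurableSet_lt measurable_fst (measurable_const.add (measurable_const.mul
          (measurable_snd.sub measurable_const)))))
  · rintro p (hL | hU)
    · rw [Set.mem_setOf_eq] at hL
      obtain ⟨h1, h2, h3, h4⟩ := hL
      have h5 : κ * (p.1 - y0) ≤ κ * (y1 - y0) := mul_le_mul_of_nonneg_left (by linarith) hκ0.le
      rw [hκ] at h5
      exact ⟨⟨h1.le, h2⟩, h3, by linarith⟩
    · rw [Set.mem_setOf_eq] at hU
      obtain ⟨h1, h2, h3, h4⟩ := hU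
      have h5 : κ' * (p.2 - z0) ≤ κ' * (z1 - z0) := mul_le_mul_of_nonneg_left (by linarith) hκ'0.le
      rw [hκ'] at h5
      exact ⟨⟨h3, by linarith⟩, h1.le, h2⟩
  · rintro p ⟨hp, hn⟩
    rw [Set.mem_prod, Set.mem_Icc, Set.mem_Icc] at hp
    obtain ⟨⟨h1, h2⟩, h3, h4⟩ := hp
    rw [Set.mem_union, not_or, Set.mem_setOf_eq, Set.mem_setOf_eq] at hn
    obtain ⟨hnL, hnU⟩ := hn
    rw [Set.mem_singleton_iff]
    rcases le_or_gt p.2 (z0 + κ * (p.1 - y0)) with hle | hlt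
    · have hx0 : p.1 = y0 := by
        by_contra hne
        exact hnL ⟨lt_of_le_of_ne h1 (Ne.symm hne), h2, h3, hle⟩
      have hy0 : p.2 = z0 := by
        rw [hx0, sub_self, mul_zero, add_zero] at hle
        exact le_antisymm hle h3
      exact Prod.ext hx0 hy0
    · exfalso
      have hy0 : z0 < p.2 := by nlinarith [mul_nonneg hκ0.le (sub_nonneg.2 h1)]
      have key : κ' * (κ * (p.1 - y0)) = p.1 - y0 := by rw [← mul_assoc, hκκ, one_mul]
      have h5 : κ' * (κ * (p.1 - y0)) < κ' * (p.2 - z0) := mul_lt_mul_of_pos_left (by linarith) hκ'0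
      rw [key] at h5
      exact hnU ⟨hy0, h4, h1, by linarith⟩

/-- **Duffy's decomposition of a box along the diagonal plane through the singular edge** `{y = y0, z = z0}`:
with `κ (y1 − y0) = z1 − z0` and `κ' (z1 − z0) = y1 − y0`, if the two transformed integrands are integrable on their
closed parameter boxes then `f` is integrable on `[x0, x1] × [y0, y1] × [z0, z1]` and
`∫_R f = ∫_{[x0,x1]×[y0,y1]×[0,1]} κ (y − y0) f(x, y, z0 + κ (y − y0) t)
      + ∫_{[x0,x1]×[z0,z1]×[0,1]} κ' (z − z0) f(x, y0 + κ' (z − z0) t, z)`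
(op. cit., applied in each transverse plane: the rectangle "can be divided into triangles … with the singularity
lying at a vertex … and the transformation can be applied to each subdomain separately").
[cite: Duffy1982, p. 1260] [cite: MousaviSukumar2009, Sect. 1] [cite: DavisRabinowitz1984, Sect. 5.6] -/
theorem duffyE_split {x0 x1 y0 y1 z0 z1 κ κ' : ℝ} (hy : y0 < y1) (hz : z0 < z1)
    (hκ : κ * (y1 - y0) = z1 - z0) (hκ' : κ' * (z1 - z0) = y1 - y0) {f : ℝ × ℝ × ℝ → ℝ}
    (h₁ : IntegrableOn (fun p : ℝ × ℝ × ℝ => κ * (p.2.1 - y0) * f (p.1, p.2.1, z0 + κ * (p.2.1 - y0) * p.2.2))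
      (Icc x0 x1 ×ˢ (Icc y0 y1 ×ˢ Icc (0 : ℝ) 1)) volume)
    (h₂ : IntegrableOn (fun p : ℝ × ℝ × ℝ => κ' * (p.2.1 - z0) * f (p.1, y0 + κ' * (p.2.1 - z0) * p.2.2, p.2.1))
      (Icc x0 x1 ×ˢ (Icc z0 z1 ×ˢ Icc (0 : ℝ) 1)) volume) :
    IntegrableOn f (Icc x0 x1 ×ˢ (Icc y0 y1 ×ˢ Icc z0 z1)) volume ∧
      ∫ p in Icc x0 x1 ×ˢ (Icc y0 y1 ×ˢ Icc z0 z1), f p =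
        (∫ p in Icc x0 x1 ×ˢ (Icc y0 y1 ×ˢ Icc (0 : ℝ) 1),
            κ * (p.2.1 - y0) * f (p.1, p.2.1, z0 + κ * (p.2.1 - y0) * p.2.2)) +
          ∫ p in Icc x0 x1 ×ˢ (Icc z0 z1 ×ˢ Icc (0 : ℝ) 1),
            κ' * (p.2.1 - z0) * f (p.1, y0 + κ' * (p.2.1 - z0) * p.2.2, p.2.1) := by
  obtain ⟨hκ0, hκ'0, hdisj, hTUm, hsub, hcov⟩ := transverse_triangles hy hz hκ hκ'
  set TL : Set (ℝ × ℝ) := {q : ℝ × ℝ | y0 < q.1 ∧ q.1 ≤ y1 ∧ z0 ≤ q.2 ∧ q.2 ≤ z0 + κ * (q.1 - y0)} with hTL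
  set TU : Set (ℝ × ℝ) := {q : ℝ × ℝ | z0 < q.2 ∧ q.2 ≤ z1 ∧ y0 ≤ q.1 ∧ q.1 < y0 + κ' * (q.2 - z0)} with hTU
  obtain ⟨eL, iL⟩ := setIntegral_duffyEL hκ0 x0 x1 y0 y1 z0 f
  obtain ⟨eU, iU⟩ := setIntegral_duffyEU hκ'0 x0 x1 y0 z0 z1 f
  rw [← hTL] at eL iL
  rw [← hTU] at eU iU
  have hfL : IntegrableOn f (Icc x0 x1 ×ˢ TL) volume := iL.2 h₁
  have hfU : IntegrableOn f (Icc x0 x1 ×ˢ TU) volume := iU.2 h₂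
  have hdisj3 : Disjoint (Icc x0 x1 ×ˢ TL) (Icc x0 x1 ×ˢ TU) :=
    Set.disjoint_prod.2 (Or.inr hdisj)
  have hTUm3 : MeasurableSet (Icc x0 x1 ×ˢ TU) := measurableSet_Icc.prod hTUm
  have hae : (Icc x0 x1 ×ˢ TL ∪ Icc x0 x1 ×ˢ TU : Set (ℝ × ℝ × ℝ)) =ᵐ[volume]
      (Icc x0 x1 ×ˢ (Icc y0 y1 ×ˢ Icc z0 z1) : Set (ℝ × ℝ × ℝ)) := by
    rw [← Set.prod_union]
    refine ae_eq_set.2 ⟨?_, ?_⟩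
    · exact measure_mono_null (fun p hp => (hp.2 ⟨hp.1.1, hsub hp.1.2⟩).elim) measure_empty
    · have hcov3 : Icc x0 x1 ×ˢ (Icc y0 y1 ×ˢ Icc z0 z1) \ Icc x0 x1 ×ˢ (TL ∪ TU) ⊆
          (Icc x0 x1 ×ˢ {(y0, z0)} : Set (ℝ × ℝ × ℝ)) := by
        rintro p ⟨hp, hn⟩
        refine ⟨hp.1, hcov ⟨hp.2, fun h => hn ⟨hp.1, h⟩⟩⟩
      refine measure_mono_null hcov3 ?_
      rw [Measure.volume_eq_prod, Measure.prod_prod, measure_singleton, mul_zero]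
  have hfLU : IntegrableOn f (Icc x0 x1 ×ˢ TL ∪ Icc x0 x1 ×ˢ TU) volume := hfL.union hfU
  refine ⟨hfLU.congr_set_ae hae.symm, ?_⟩
  rw [← setIntegral_congr_set hae, setIntegral_union hdisj3 hTUm3 hfL hfU, eL, eU]

/-! ### Part B. The certificate for an edge singularity -/

/-- [folklore] -/
private theorem Icc3_ae_eq_Ioo3' (a b c d e k : ℝ) :
    (Icc a b ×ˢ (Icc c d ×ˢ Icc e k) : Set (ℝ × ℝ × ℝ)) =ᵐ[volume]
      (Ioo a b ×ˢ (Ioo c d ×ˢ Ioo e k) : Set (ℝ × ℝ × ℝ)) := by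
  rw [Measure.volume_eq_prod]
  refine Measure.set_prod_ae_eq Ioo_ae_eq_Icc.symm ?_
  rw [Measure.volume_eq_prod]
  exact Measure.set_prod_ae_eq Ioo_ae_eq_Icc.symm Ioo_ae_eq_Icc.symm

/-- [folklore] -/
private theorem transfer_open_box3' {g w : ℝ × ℝ × ℝ → ℝ} {a b c d e k : ℝ}
    (heq : ∀ p : ℝ × ℝ × ℝ, a < p.1 → p.1 < b → c < p.2.1 → p.2.1 < d → e < p.2.2 → p.2.2 < k → g p = w p)
    (hw : IntegrableOn w (Icc a b ×ˢ (Icc c d ×ˢ Icc e k)) volume) :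
    IntegrableOn g (Icc a b ×ˢ (Icc c d ×ˢ Icc e k)) volume ∧
      ∫ p in Icc a b ×ˢ (Icc c d ×ˢ Icc e k), g p = ∫ p in Icc a b ×ˢ (Icc c d ×ˢ Icc e k), w p := by
  have hae := Icc3_ae_eq_Ioo3' a b c d e k
  have heqOn : EqOn g w (Ioo a b ×ˢ (Ioo c d ×ˢ Ioo e k)) := by
    intro p hp
    rw [Set.mem_prod, Set.mem_prod, Set.mem_Ioo, Set.mem_Ioo, Set.mem_Ioo] at hp
    exact heq p hp.1.1 hp.1.2 hp.2.1.1 hp.2.1.2 hp.2.2.1 hp.2.2.2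
  have hm : MeasurableSet (Ioo a b ×ˢ (Ioo c d ×ˢ Ioo e k) : Set (ℝ × ℝ × ℝ)) :=
    measurableSet_Ioo.prod (measurableSet_Ioo.prod measurableSet_Ioo)
  refine ⟨((integrableOn_congr_fun heqOn hm).2 (hw.congr_set_ae hae.symm)).congr_set_ae hae, ?_⟩
  rw [setIntegral_congr_set hae, setIntegral_congr_set hae, setIntegral_congr_fun hm heqOn]

/-- **Kernel-checked bounds for a triple integral with an algebraic singularity along the edge `{y = y0, z = z0}`**
of the rational box `R = [x0, x1] × [y0, y1] × [z0, z1]` (Duffy's transformation in the transverse variables on the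
two prisms, composed with the face-weighted 3-D kd-tree certificate; the slopes `κ = (z1 − z0)/(y1 − y0)` and
`κ' = (y1 − y0)/(z1 − z0)` given as rationals).  HYPOTHESES ON `f`: only the two pointwise identities on the OPEN
parameter boxes `(x0, x1) × (y0, y1) × (0, 1)` and `(x0, x1) × (z0, z1) × (0, 1)` exhibiting the transformed integrands
`κ (y − y0) f(x, y, z0 + κ (y − y0) t)` and `κ' (z − z0) f(x, y0 + κ' (z − z0) t, z)` as face-weighted code-list
integrands `wfunL3 ω₁ ⟨x0, x1, y0, y1, 0, 1⟩ F₁ x y t`, `wfunL3 ω₂ ⟨x0, x1, z0, z1, 0, 1⟩ F₂ x z t` (a line singularity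
`ρ^{−σ}`, `σ < 2`, `ρ` the distance to the edge, becomes the face weight `(y − y0)^{1−σ}` resp. `(z − z0)^{1−σ}` times a
code list regular on the closed parameter box; factors singular on the faces `x = x0`, `x = x1`, `y = y1`, `z = z1` stay
face weights), plus the `decide`-able obligations of the two certificates.  CONCLUSION: `f` is integrable on the closed
box and `lo₁ + lo₂ ≤ ∫_{x0}^{x1} ∫_{y0}^{y1} ∫_{z0}^{z1} f ≤ hi₁ + hi₂`.
[cite: Duffy1982, p. 1260] [cite: MousaviSukumar2009, Sect. 1] [cite: DavisRabinowitz1984, Sect. 5.8]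
[cite: DavisRabinowitz1984, Sect. 5.6] [cite: DavisRabinowitz1984, Sect. 2.12.5] [cite: MakinoBerz2003, Algorithm 2]
[cite: MahboubiMelquiondSibutpinote2016, Sect. 3.3] -/
theorem integral_bounds_of_duffyECheckWL3 {S : ℕ} {R : Box3Q} {κ κ' : ℚ} (hx : R.x0 < R.x1)
    (hy : R.y0 < R.y1) (hz : R.z0 < R.z1)
    (hκ : κ * (R.y1 - R.y0) = R.z1 - R.z0) (hκ' : κ' * (R.z1 - R.z0) = R.y1 - R.y0)
    {f : ℝ → ℝ → ℝ → ℝ} {F₁ F₂ : BExpr3T} {ω₁ ω₂ : WLPrm3} {t₁ t₂ : KdTree3} {n₁ n₂ : ℕ}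
    {lo₁ hi₁ lo₂ hi₂ : ℚ}
    (hf₁ : ∀ x y t : ℝ, (R.x0 : ℝ) < x → x < R.x1 → (R.y0 : ℝ) < y → y < R.y1 → 0 < t → t < 1 →
      (κ : ℝ) * (y - R.y0) * f x y (R.z0 + κ * (y - R.y0) * t) = wfunL3 ω₁ ⟨R.x0, R.x1, R.y0, R.y1, 0, 1⟩ F₁ x y t)
    (hf₂ : ∀ x z t : ℝ, (R.x0 : ℝ) < x → x < R.x1 → (R.z0 : ℝ) < z → z < R.z1 → 0 < t → t < 1 →
      (κ' : ℝ) * (z - R.z0) * f x (R.y0 + κ' * (z - R.z0) * t) z = wfunL3 ω₂ ⟨R.x0, R.x1, R.z0, R.z1, 0, 1⟩ F₂ x z t)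
    (hleaf₁ : ∀ i : ℕ, i < n₁ → leafCheckWL3 S F₁ ω₁ ⟨R.x0, R.x1, R.y0, R.y1, 0, 1⟩ t₁ i = true)
    (ht₁ : treeCheckWL3 S t₁ n₁ lo₁ hi₁ = true)
    (hleaf₂ : ∀ i : ℕ, i < n₂ → leafCheckWL3 S F₂ ω₂ ⟨R.x0, R.x1, R.z0, R.z1, 0, 1⟩ t₂ i = true)
    (ht₂ : treeCheckWL3 S t₂ n₂ lo₂ hi₂ = true) :
    IntegrableOn (fun p : ℝ × ℝ × ℝ => f p.1 p.2.1 p.2.2)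
        (Icc (R.x0 : ℝ) R.x1 ×ˢ (Icc (R.y0 : ℝ) R.y1 ×ˢ Icc (R.z0 : ℝ) R.z1)) volume ∧
      ((lo₁ + lo₂ : ℚ) : ℝ) ≤
          ∫ x in (R.x0 : ℝ)..R.x1, ∫ y in (R.y0 : ℝ)..R.y1, ∫ z in (R.z0 : ℝ)..R.z1, f x y z ∧
        ∫ x in (R.x0 : ℝ)..R.x1, ∫ y in (R.y0 : ℝ)..R.y1, ∫ z in (R.z0 : ℝ)..R.z1, f x y z ≤
          ((hi₁ + hi₂ : ℚ) : ℝ) := by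
  -- the two face-weighted certificates: enclosures and joint integrability, then Fubini
  obtain ⟨hlo₁, hhi₁⟩ := integral_bounds_of_leafCheck3R (f := wfunL3 ω₁ ⟨R.x0, R.x1, R.y0, R.y1, 0, 1⟩ F₁)
    (Λ := leafEnclWL3 S F₁ ω₁ ⟨R.x0, R.x1, R.y0, R.y1, 0, 1⟩)
    (fun hS B P hok => leafEnclWL3_sound hS F₁ ω₁ _ B P hok) hleaf₁ ht₁
  obtain ⟨hlo₂, hhi₂⟩ := integral_bounds_of_leafCheck3R (f := wfunL3 ω₂ ⟨R.x0, R.x1, R.z0, R.z1, 0, 1⟩ F₂)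
    (Λ := leafEnclWL3 S F₂ ω₂ ⟨R.x0, R.x1, R.z0, R.z1, 0, 1⟩)
    (fun hS B P hok => leafEnclWL3_sound hS F₂ ω₂ _ B P hok) hleaf₂ ht₂
  obtain ⟨hI₁, -, -, -⟩ := integrableOn_wfunL3_of_leafCheckWL3 hleaf₁ ht₁
  obtain ⟨hI₂, -, -, -⟩ := integrableOn_wfunL3_of_leafCheckWL3 hleaf₂ ht₂
  simp only [Rat.cast_zero, Rat.cast_one] at hlo₁ hhi₁ hlo₂ hhi₂ hI₁ hI₂
  have hxr : (R.x0 : ℝ) < R.x1 := by exact_mod_cast hx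
  have hyr : (R.y0 : ℝ) < R.y1 := by exact_mod_cast hy
  have hzr : (R.z0 : ℝ) < R.z1 := by exact_mod_cast hz
  rw [intervalIntegral_iterated3_eq_setIntegral_prod hxr.le hyr.le zero_le_one hI₁] at hlo₁ hhi₁
  rw [intervalIntegral_iterated3_eq_setIntegral_prod hxr.le hzr.le zero_le_one hI₂] at hlo₂ hhi₂
  -- the transformed integrands agree with the weighted integrands on the open parameter boxes
  obtain ⟨hg₁, eg₁⟩ := transfer_open_box3'
    (g := fun p : ℝ × ℝ × ℝ => (κ : ℝ) * (p.2.1 - R.y0) * f p.1 p.2.1 (R.z0 + κ * (p.2.1 - R.y0) * p.2.2))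
    (w := fun p : ℝ × ℝ × ℝ => wfunL3 ω₁ ⟨R.x0, R.x1, R.y0, R.y1, 0, 1⟩ F₁ p.1 p.2.1 p.2.2)
    (fun p h1 h2 h3 h4 h5 h6 => hf₁ p.1 p.2.1 p.2.2 h1 h2 h3 h4 h5 h6) hI₁
  obtain ⟨hg₂, eg₂⟩ := transfer_open_box3'
    (g := fun p : ℝ × ℝ × ℝ => (κ' : ℝ) * (p.2.1 - R.z0) * f p.1 (R.y0 + κ' * (p.2.1 - R.z0) * p.2.2) p.2.1)
    (w := fun p : ℝ × ℝ × ℝ => wfunL3 ω₂ ⟨R.x0, R.x1, R.z0, R.z1, 0, 1⟩ F₂ p.1 p.2.1 p.2.2)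
    (fun p h1 h2 h3 h4 h5 h6 => hf₂ p.1 p.2.1 p.2.2 h1 h2 h3 h4 h5 h6) hI₂
  -- Duffy's decomposition into the two prisms
  have hκr : (κ : ℝ) * (R.y1 - R.y0) = R.z1 - R.z0 := by exact_mod_cast hκ
  have hκ'r : (κ' : ℝ) * (R.z1 - R.z0) = R.y1 - R.y0 := by exact_mod_cast hκ'
  obtain ⟨hIf, ef⟩ := duffyE_split (x0 := (R.x0 : ℝ)) (x1 := (R.x1 : ℝ)) (f := fun p : ℝ × ℝ × ℝ => f p.1 p.2.1 p.2.2)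
    hyr hzr hκr hκ'r hg₁ hg₂
  refine ⟨hIf, ?_, ?_⟩
  · rw [intervalIntegral_iterated3_eq_setIntegral_prod hxr.le hyr.le hzr.le hIf, ef, eg₁, eg₂]
    push_cast
    linarith
  · rw [intervalIntegral_iterated3_eq_setIntegral_prod hxr.le hyr.le hzr.le hIf, ef, eg₁, eg₂]
    push_cast
    linarith

/-! ### Part C. Orientation: coordinate permutations of the box, edges parallel to the `y`- and `z`-axes -/

/-- The cyclic permutation of coordinates `(a, b, c) ↦ (b, c, a)` of `ℝ × ℝ × ℝ` as a measurable equivalence (a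
nonsingular affine change of variables of the box onto a box, op. cit. (5.4.7); used to change the order of
integration). [cite: DavisRabinowitz1984, Sect. 5.4] [cite: DavisRabinowitz1984, Sect. 5.3] -/
def cycle3 : (ℝ × ℝ × ℝ) ≃ᵐ ℝ × ℝ × ℝ := MeasurableEquiv.prodComm.trans MeasurableEquiv.prodAssoc

/-- [cite: DavisRabinowitz1984, Sect. 5.4] -/
@[simp] theorem cycle3_apply (p : ℝ × ℝ × ℝ) : cycle3 p = (p.2.1, p.2.2, p.1) := rfl

/-- [cite: DavisRabinowitz1984, Sect. 5.4] -/
@[simp] theorem cycle3_symm_apply (p : ℝ × ℝ × ℝ) : cycle3.symm p = (p.2.2, p.1, p.2.1) := rfl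

/-- The cyclic permutation of coordinates preserves Lebesgue measure (Jacobian of modulus one).
[cite: DavisRabinowitz1984, Sect. 5.4] -/
theorem measurePreserving_cycle3 : MeasurePreserving cycle3 volume volume :=
  (Measure.measurePreserving_swap (μ := (volume : Measure ℝ)) (ν := (volume : Measure (ℝ × ℝ)))).trans
    (measurePreserving_prodAssoc (volume : Measure ℝ) (volume : Measure ℝ) (volume : Measure ℝ))

/-- [folklore] Transport of a set integral and of integrability along a measure-preserving equivalence. -/
private theorem setIntegral_comp_equiv3 {e : (ℝ × ℝ × ℝ) ≃ᵐ ℝ × ℝ × ℝ} (he : MeasurePreserving e volume volume)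
    (F : ℝ × ℝ × ℝ → ℝ) {s s' : Set (ℝ × ℝ × ℝ)} (hs : e ⁻¹' s = s') :
    (∫ p in s', F (e p) = ∫ p in s, F p) ∧
      (IntegrableOn (fun p : ℝ × ℝ × ℝ => F (e p)) s' volume ↔ IntegrableOn F s volume) := by
  subst hs
  exact ⟨he.setIntegral_preimage_emb e.measurableEmbedding F s,
    he.integrableOn_comp_preimage e.measurableEmbedding⟩

/-- **Change of the order of integration over a box, I** (the third variable outermost): for any `F`,
`∫_{[e,g]×[a,b]×[c,d]} F(p₂, p₃, p₁) dp = ∫_{[a,b]×[c,d]×[e,g]} F`, and `F ∘ (cyclic permutation)` is integrable on the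
permuted box iff `F` is integrable on the box. [cite: DavisRabinowitz1984, Sect. 5.3] [cite: DavisRabinowitz1984, Sect. 5.4] -/
theorem setIntegral_box3_cycle (F : ℝ × ℝ × ℝ → ℝ) (a b c d e g : ℝ) :
    (∫ p in Icc e g ×ˢ (Icc a b ×ˢ Icc c d), F (p.2.1, p.2.2, p.1) =
        ∫ p in Icc a b ×ˢ (Icc c d ×ˢ Icc e g), F p) ∧
      (IntegrableOn (fun p : ℝ × ℝ × ℝ => F (p.2.1, p.2.2, p.1)) (Icc e g ×ˢ (Icc a b ×ˢ Icc c d)) volume ↔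
        IntegrableOn F (Icc a b ×ˢ (Icc c d ×ˢ Icc e g)) volume) := by
  have hpre : (cycle3 : ℝ × ℝ × ℝ → ℝ × ℝ × ℝ) ⁻¹' (Icc a b ×ˢ (Icc c d ×ˢ Icc e g)) =
      Icc e g ×ˢ (Icc a b ×ˢ Icc c d) := by
    ext p
    simp only [Set.mem_preimage, Set.mem_prod, cycle3_apply]
    tauto
  simpa only [cycle3_apply] using setIntegral_comp_equiv3 measurePreserving_cycle3 F hpre

/-- **Change of the order of integration over a box, II** (the second variable outermost, then the third):
`∫_{[c,d]×[e,g]×[a,b]} F(p₃, p₁, p₂) dp = ∫_{[a,b]×[c,d]×[e,g]} F`, with the transfer of integrability.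
[cite: DavisRabinowitz1984, Sect. 5.3] [cite: DavisRabinowitz1984, Sect. 5.4] -/
theorem setIntegral_box3_cycle' (F : ℝ × ℝ × ℝ → ℝ) (a b c d e g : ℝ) :
    (∫ p in Icc c d ×ˢ (Icc e g ×ˢ Icc a b), F (p.2.2, p.1, p.2.1) =
        ∫ p in Icc a b ×ˢ (Icc c d ×ˢ Icc e g), F p) ∧
      (IntegrableOn (fun p : ℝ × ℝ × ℝ => F (p.2.2, p.1, p.2.1)) (Icc c d ×ˢ (Icc e g ×ˢ Icc a b)) volume ↔
        IntegrableOn F (Icc a b ×ˢ (Icc c d ×ˢ Icc e g)) volume) := by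
  have hpre : (cycle3.symm : ℝ × ℝ × ℝ → ℝ × ℝ × ℝ) ⁻¹' (Icc a b ×ˢ (Icc c d ×ˢ Icc e g)) =
      Icc c d ×ˢ (Icc e g ×ˢ Icc a b) := by
    ext p
    simp only [Set.mem_preimage, Set.mem_prod, cycle3_symm_apply]
    tauto
  simpa only [cycle3_symm_apply] using
    setIntegral_comp_equiv3 (measurePreserving_cycle3.symm cycle3) F hpre

/-- **Change of order of integration in the iterated integral over a box** (`z` outermost): if
`(x, y, z) ↦ f x y z` is integrable on `[a, b] × [c, d] × [e, g]` then
`∫_e^g ∫_a^b ∫_c^d f x y z dy dx dz = ∫_a^b ∫_c^d ∫_e^g f x y z dz dy dx`, and the permuted integrand is integrable on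
the permuted box. [cite: DavisRabinowitz1984, Sect. 5.3] -/
theorem integral3_order_zxy {f : ℝ → ℝ → ℝ → ℝ} {a b c d e g : ℝ} (hab : a ≤ b) (hcd : c ≤ d) (heg : e ≤ g)
    (hf : IntegrableOn (fun p : ℝ × ℝ × ℝ => f p.1 p.2.1 p.2.2) (Icc a b ×ˢ (Icc c d ×ˢ Icc e g)) volume) :
    IntegrableOn (fun p : ℝ × ℝ × ℝ => f p.2.1 p.2.2 p.1) (Icc e g ×ˢ (Icc a b ×ˢ Icc c d)) volume ∧
      ∫ z in e..g, ∫ x in a..b, ∫ y in c..d, f x y z = ∫ x in a..b, ∫ y in c..d, ∫ z in e..g, f x y z := by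
  obtain ⟨he, hi⟩ := setIntegral_box3_cycle (fun p : ℝ × ℝ × ℝ => f p.1 p.2.1 p.2.2) a b c d e g
  have hf' : IntegrableOn (fun p : ℝ × ℝ × ℝ => f p.2.1 p.2.2 p.1) (Icc e g ×ˢ (Icc a b ×ˢ Icc c d)) volume :=
    hi.2 hf
  have e1 : ∫ z in e..g, ∫ x in a..b, ∫ y in c..d, f x y z =
      ∫ p in Icc e g ×ˢ (Icc a b ×ˢ Icc c d), f p.2.1 p.2.2 p.1 :=
    intervalIntegral_iterated3_eq_setIntegral_prod (f := fun z x y => f x y z) heg hab hcd hf'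
  refine ⟨hf', ?_⟩
  rw [e1, intervalIntegral_iterated3_eq_setIntegral_prod hab hcd heg hf, he]

/-- **Change of order of integration in the iterated integral over a box** (`y` outermost, then `z`, then `x`).
[cite: DavisRabinowitz1984, Sect. 5.3] -/
theorem integral3_order_yzx {f : ℝ → ℝ → ℝ → ℝ} {a b c d e g : ℝ} (hab : a ≤ b) (hcd : c ≤ d) (heg : e ≤ g)
    (hf : IntegrableOn (fun p : ℝ × ℝ × ℝ => f p.1 p.2.1 p.2.2) (Icc a b ×ˢ (Icc c d ×ˢ Icc e g)) volume) :
    IntegrableOn (fun p : ℝ × ℝ × ℝ => f p.2.2 p.1 p.2.1) (Icc c d ×ˢ (Icc e g ×ˢ Icc a b)) volume ∧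
      ∫ y in c..d, ∫ z in e..g, ∫ x in a..b, f x y z = ∫ x in a..b, ∫ y in c..d, ∫ z in e..g, f x y z := by
  obtain ⟨he, hi⟩ := setIntegral_box3_cycle' (fun p : ℝ × ℝ × ℝ => f p.1 p.2.1 p.2.2) a b c d e g
  have hf' : IntegrableOn (fun p : ℝ × ℝ × ℝ => f p.2.2 p.1 p.2.1) (Icc c d ×ˢ (Icc e g ×ˢ Icc a b)) volume :=
    hi.2 hf
  have e1 : ∫ y in c..d, ∫ z in e..g, ∫ x in a..b, f x y z =
      ∫ p in Icc c d ×ˢ (Icc e g ×ˢ Icc a b), f p.2.2 p.1 p.2.1 :=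
    intervalIntegral_iterated3_eq_setIntegral_prod (f := fun y z x => f x y z) hcd heg hab hf'
  refine ⟨hf', ?_⟩
  rw [e1, intervalIntegral_iterated3_eq_setIntegral_prod hab hcd heg hf, he]

/-- **Edge singularity along `{x = x0, y = y0}`** (a line parallel to the `z`-axis): the certificate of
`integral_bounds_of_duffyECheckWL3` in the coordinates `(z, x, y)` — Duffy's maps in the transverse variables
`(x, y)` with vertex `(x0, y0)`, slopes `κ (x1 − x0) = y1 − y0`, `κ' (y1 − y0) = x1 − x0`; the transformed integrands
`κ (x − x0) f(x, y0 + κ (x − x0) t, z)` on `(z0, z1) × (x0, x1) × (0, 1)` and `κ' (y − y0) f(x0 + κ' (y − y0) t, y, z)`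
on `(z0, z1) × (y0, y1) × (0, 1)` — transported back by the change of the order of integration.
[cite: Duffy1982, p. 1260] [cite: DavisRabinowitz1984, Sect. 5.3] [cite: DavisRabinowitz1984, Sect. 5.8]
[cite: MahboubiMelquiondSibutpinote2016, Sect. 3.3] -/
theorem integral_bounds_of_duffyECheckWL3_zEdge {S : ℕ} {R : Box3Q} {κ κ' : ℚ} (hx : R.x0 < R.x1)
    (hy : R.y0 < R.y1) (hz : R.z0 < R.z1)
    (hκ : κ * (R.x1 - R.x0) = R.y1 - R.y0) (hκ' : κ' * (R.y1 - R.y0) = R.x1 - R.x0)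
    {f : ℝ → ℝ → ℝ → ℝ} {F₁ F₂ : BExpr3T} {ω₁ ω₂ : WLPrm3} {t₁ t₂ : KdTree3} {n₁ n₂ : ℕ}
    {lo₁ hi₁ lo₂ hi₂ : ℚ}
    (hf₁ : ∀ z x t : ℝ, (R.z0 : ℝ) < z → z < R.z1 → (R.x0 : ℝ) < x → x < R.x1 → 0 < t → t < 1 →
      (κ : ℝ) * (x - R.x0) * f x (R.y0 + κ * (x - R.x0) * t) z = wfunL3 ω₁ ⟨R.z0, R.z1, R.x0, R.x1, 0, 1⟩ F₁ z x t)
    (hf₂ : ∀ z y t : ℝ, (R.z0 : ℝ) < z → z < R.z1 → (R.y0 : ℝ) < y → y < R.y1 → 0 < t → t < 1 →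
      (κ' : ℝ) * (y - R.y0) * f (R.x0 + κ' * (y - R.y0) * t) y z = wfunL3 ω₂ ⟨R.z0, R.z1, R.y0, R.y1, 0, 1⟩ F₂ z y t)
    (hleaf₁ : ∀ i : ℕ, i < n₁ → leafCheckWL3 S F₁ ω₁ ⟨R.z0, R.z1, R.x0, R.x1, 0, 1⟩ t₁ i = true)
    (ht₁ : treeCheckWL3 S t₁ n₁ lo₁ hi₁ = true)
    (hleaf₂ : ∀ i : ℕ, i < n₂ → leafCheckWL3 S F₂ ω₂ ⟨R.z0, R.z1, R.y0, R.y1, 0, 1⟩ t₂ i = true)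
    (ht₂ : treeCheckWL3 S t₂ n₂ lo₂ hi₂ = true) :
    IntegrableOn (fun p : ℝ × ℝ × ℝ => f p.1 p.2.1 p.2.2)
        (Icc (R.x0 : ℝ) R.x1 ×ˢ (Icc (R.y0 : ℝ) R.y1 ×ˢ Icc (R.z0 : ℝ) R.z1)) volume ∧
      ((lo₁ + lo₂ : ℚ) : ℝ) ≤
          ∫ x in (R.x0 : ℝ)..R.x1, ∫ y in (R.y0 : ℝ)..R.y1, ∫ z in (R.z0 : ℝ)..R.z1, f x y z ∧
        ∫ x in (R.x0 : ℝ)..R.x1, ∫ y in (R.y0 : ℝ)..R.y1, ∫ z in (R.z0 : ℝ)..R.z1, f x y z ≤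
          ((hi₁ + hi₂ : ℚ) : ℝ) := by
  obtain ⟨hIg, hlo, hhi⟩ := integral_bounds_of_duffyECheckWL3 (R := ⟨R.z0, R.z1, R.x0, R.x1, R.y0, R.y1⟩)
    (κ := κ) (κ' := κ') (f := fun a b c => f b c a) hz hx hy hκ hκ' hf₁ hf₂ hleaf₁ ht₁ hleaf₂ ht₂
  dsimp only at hIg hlo hhi
  have hxr : (R.x0 : ℝ) ≤ R.x1 := by exact_mod_cast hx.le
  have hyr : (R.y0 : ℝ) ≤ R.y1 := by exact_mod_cast hy.le
  have hzr : (R.z0 : ℝ) ≤ R.z1 := by exact_mod_cast hz.le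
  have hIf : IntegrableOn (fun p : ℝ × ℝ × ℝ => f p.1 p.2.1 p.2.2)
      (Icc (R.x0 : ℝ) R.x1 ×ˢ (Icc (R.y0 : ℝ) R.y1 ×ˢ Icc (R.z0 : ℝ) R.z1)) volume :=
    (setIntegral_box3_cycle (fun p : ℝ × ℝ × ℝ => f p.1 p.2.1 p.2.2) R.x0 R.x1 R.y0 R.y1 R.z0 R.z1).2.1 hIg
  have e3 := (integral3_order_zxy hxr hyr hzr hIf).2
  rw [← e3]
  exact ⟨hIf, hlo, hhi⟩

/-- **Edge singularity along `{x = x0, z = z0}`** (a line parallel to the `y`-axis): Duffy's maps in the transverse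
variables `(z, x)` with vertex `(z0, x0)`, slopes `κ (z1 − z0) = x1 − x0`, `κ' (x1 − x0) = z1 − z0`; the transformed
integrands `κ (z − z0) f(x0 + κ (z − z0) t, y, z)` on `(y0, y1) × (z0, z1) × (0, 1)` and
`κ' (x − x0) f(x, y, z0 + κ' (x − x0) t)` on `(y0, y1) × (x0, x1) × (0, 1)`.
[cite: Duffy1982, p. 1260] [cite: DavisRabinowitz1984, Sect. 5.3] [cite: DavisRabinowitz1984, Sect. 5.8]
[cite: MahboubiMelquiondSibutpinote2016, Sect. 3.3] -/
theorem integral_bounds_of_duffyECheckWL3_yEdge {S : ℕ} {R : Box3Q} {κ κ' : ℚ} (hx : R.x0 < R.x1)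
    (hy : R.y0 < R.y1) (hz : R.z0 < R.z1)
    (hκ : κ * (R.z1 - R.z0) = R.x1 - R.x0) (hκ' : κ' * (R.x1 - R.x0) = R.z1 - R.z0)
    {f : ℝ → ℝ → ℝ → ℝ} {F₁ F₂ : BExpr3T} {ω₁ ω₂ : WLPrm3} {t₁ t₂ : KdTree3} {n₁ n₂ : ℕ}
    {lo₁ hi₁ lo₂ hi₂ : ℚ}
    (hf₁ : ∀ y z t : ℝ, (R.y0 : ℝ) < y → y < R.y1 → (R.z0 : ℝ) < z → z < R.z1 → 0 < t → t < 1 →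
      (κ : ℝ) * (z - R.z0) * f (R.x0 + κ * (z - R.z0) * t) y z = wfunL3 ω₁ ⟨R.y0, R.y1, R.z0, R.z1, 0, 1⟩ F₁ y z t)
    (hf₂ : ∀ y x t : ℝ, (R.y0 : ℝ) < y → y < R.y1 → (R.x0 : ℝ) < x → x < R.x1 → 0 < t → t < 1 →
      (κ' : ℝ) * (x - R.x0) * f x y (R.z0 + κ' * (x - R.x0) * t) = wfunL3 ω₂ ⟨R.y0, R.y1, R.x0, R.x1, 0, 1⟩ F₂ y x t)
    (hleaf₁ : ∀ i : ℕ, i < n₁ → leafCheckWL3 S F₁ ω₁ ⟨R.y0, R.y1, R.z0, R.z1, 0, 1⟩ t₁ i = true)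
    (ht₁ : treeCheckWL3 S t₁ n₁ lo₁ hi₁ = true)
    (hleaf₂ : ∀ i : ℕ, i < n₂ → leafCheckWL3 S F₂ ω₂ ⟨R.y0, R.y1, R.x0, R.x1, 0, 1⟩ t₂ i = true)
    (ht₂ : treeCheckWL3 S t₂ n₂ lo₂ hi₂ = true) :
    IntegrableOn (fun p : ℝ × ℝ × ℝ => f p.1 p.2.1 p.2.2)
        (Icc (R.x0 : ℝ) R.x1 ×ˢ (Icc (R.y0 : ℝ) R.y1 ×ˢ Icc (R.z0 : ℝ) R.z1)) volume ∧
      ((lo₁ + lo₂ : ℚ) : ℝ) ≤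
          ∫ x in (R.x0 : ℝ)..R.x1, ∫ y in (R.y0 : ℝ)..R.y1, ∫ z in (R.z0 : ℝ)..R.z1, f x y z ∧
        ∫ x in (R.x0 : ℝ)..R.x1, ∫ y in (R.y0 : ℝ)..R.y1, ∫ z in (R.z0 : ℝ)..R.z1, f x y z ≤
          ((hi₁ + hi₂ : ℚ) : ℝ) := by
  obtain ⟨hIg, hlo, hhi⟩ := integral_bounds_of_duffyECheckWL3 (R := ⟨R.y0, R.y1, R.z0, R.z1, R.x0, R.x1⟩)
    (κ := κ) (κ' := κ') (f := fun a b c => f c a b) hy hz hx hκ hκ' hf₁ hf₂ hleaf₁ ht₁ hleaf₂ ht₂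
  dsimp only at hIg hlo hhi
  have hxr : (R.x0 : ℝ) ≤ R.x1 := by exact_mod_cast hx.le
  have hyr : (R.y0 : ℝ) ≤ R.y1 := by exact_mod_cast hy.le
  have hzr : (R.z0 : ℝ) ≤ R.z1 := by exact_mod_cast hz.le
  have hIf : IntegrableOn (fun p : ℝ × ℝ × ℝ => f p.1 p.2.1 p.2.2)
      (Icc (R.x0 : ℝ) R.x1 ×ˢ (Icc (R.y0 : ℝ) R.y1 ×ˢ Icc (R.z0 : ℝ) R.z1)) volume :=
    (setIntegral_box3_cycle' (fun p : ℝ × ℝ × ℝ => f p.1 p.2.1 p.2.2) R.x0 R.x1 R.y0 R.y1 R.z0 R.z1).2.1 hIg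
  have e3 := (integral3_order_yzx hxr hyr hzr hIf).2
  rw [← e3]
  exact ⟨hIf, hlo, hhi⟩

/-! ### Part D. Reflections of the box, and splitting a box into two -/

/-- [folklore] The reflection `x ↦ m − x` of the first coordinate. -/
private def reflX3 (m : ℝ) : (ℝ × ℝ × ℝ) ≃ᵐ ℝ × ℝ × ℝ :=
  (MeasurableEquiv.subLeft m).prodCongr (MeasurableEquiv.refl (ℝ × ℝ))

/-- [folklore] The reflection `y ↦ m − y` of the second coordinate. -/
private def reflY3 (m : ℝ) : (ℝ × ℝ × ℝ) ≃ᵐ ℝ × ℝ × ℝ :=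
  (MeasurableEquiv.refl ℝ).prodCongr ((MeasurableEquiv.subLeft m).prodCongr (MeasurableEquiv.refl ℝ))

/-- [folklore] The reflection `z ↦ m − z` of the third coordinate. -/
private def reflZ3 (m : ℝ) : (ℝ × ℝ × ℝ) ≃ᵐ ℝ × ℝ × ℝ :=
  (MeasurableEquiv.refl ℝ).prodCongr ((MeasurableEquiv.refl ℝ).prodCongr (MeasurableEquiv.subLeft m))

/-- [folklore] -/
private theorem reflX3_apply (m : ℝ) (p : ℝ × ℝ × ℝ) : reflX3 m p = (m - p.1, p.2) := rfl

/-- [folklore] -/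
private theorem reflY3_apply (m : ℝ) (p : ℝ × ℝ × ℝ) : reflY3 m p = (p.1, m - p.2.1, p.2.2) := rfl

/-- [folklore] -/
private theorem reflZ3_apply (m : ℝ) (p : ℝ × ℝ × ℝ) : reflZ3 m p = (p.1, p.2.1, m - p.2.2) := rfl

/-- [folklore] -/
private theorem measurePreserving_reflX3 (m : ℝ) : MeasurePreserving (reflX3 m) volume volume :=
  (Measure.measurePreserving_sub_left (volume : Measure ℝ) m).prod
    (MeasurePreserving.id (volume : Measure (ℝ × ℝ)))

/-- [folklore] -/
private theorem measurePreserving_reflY3 (m : ℝ) : MeasurePreserving (reflY3 m) volume volume :=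
  (MeasurePreserving.id (volume : Measure ℝ)).prod
    ((Measure.measurePreserving_sub_left (volume : Measure ℝ) m).prod (MeasurePreserving.id (volume : Measure ℝ)))

/-- [folklore] -/
private theorem measurePreserving_reflZ3 (m : ℝ) : MeasurePreserving (reflZ3 m) volume volume :=
  (MeasurePreserving.id (volume : Measure ℝ)).prod
    ((MeasurePreserving.id (volume : Measure ℝ)).prod (Measure.measurePreserving_sub_left (volume : Measure ℝ) m))

/-- **Reflection of the box in `x`** (`x ↦ a + b − x`, an affine change of variables of the box onto itself with
Jacobian of modulus one): integrability on the box transfers and the iterated integral is unchanged.  An edge or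
vertex singularity on the face `x = b` is thereby moved to the face `x = a`. [cite: DavisRabinowitz1984, Sect. 5.4] -/
theorem integral3_reflect_x (f : ℝ → ℝ → ℝ → ℝ) (a b c d e g : ℝ) :
    (IntegrableOn (fun p : ℝ × ℝ × ℝ => f (a + b - p.1) p.2.1 p.2.2) (Icc a b ×ˢ (Icc c d ×ˢ Icc e g)) volume ↔
        IntegrableOn (fun p : ℝ × ℝ × ℝ => f p.1 p.2.1 p.2.2) (Icc a b ×ˢ (Icc c d ×ˢ Icc e g)) volume) ∧
      ∫ x in a..b, ∫ y in c..d, ∫ z in e..g, f (a + b - x) y z =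
        ∫ x in a..b, ∫ y in c..d, ∫ z in e..g, f x y z := by
  refine ⟨?_, ?_⟩
  · have hpre : (reflX3 (a + b) : ℝ × ℝ × ℝ → ℝ × ℝ × ℝ) ⁻¹' (Icc a b ×ˢ (Icc c d ×ˢ Icc e g)) =
        Icc a b ×ˢ (Icc c d ×ˢ Icc e g) := by
      ext p
      simp only [Set.mem_preimage, Set.mem_prod, Set.mem_Icc, reflX3_apply]
      constructor
      · rintro ⟨⟨h1, h2⟩, h3⟩; exact ⟨⟨by linarith, by linarith⟩, h3⟩
      · rintro ⟨⟨h1, h2⟩, h3⟩; exact ⟨⟨by linarith, by linarith⟩, h3⟩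
    simpa only [reflX3_apply] using
      (setIntegral_comp_equiv3 (measurePreserving_reflX3 (a + b)) (fun p : ℝ × ℝ × ℝ => f p.1 p.2.1 p.2.2) hpre).2
  · have h := intervalIntegral.integral_comp_sub_left (fun x => ∫ y in c..d, ∫ z in e..g, f x y z) (a + b)
      (a := a) (b := b)
    simp only [add_sub_cancel_right, add_sub_cancel_left] at h
    exact h

/-- **Reflection of the box in `y`** (`y ↦ c + d − y`). [cite: DavisRabinowitz1984, Sect. 5.4] -/
theorem integral3_reflect_y (f : ℝ → ℝ → ℝ → ℝ) (a b c d e g : ℝ) :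
    (IntegrableOn (fun p : ℝ × ℝ × ℝ => f p.1 (c + d - p.2.1) p.2.2) (Icc a b ×ˢ (Icc c d ×ˢ Icc e g)) volume ↔
        IntegrableOn (fun p : ℝ × ℝ × ℝ => f p.1 p.2.1 p.2.2) (Icc a b ×ˢ (Icc c d ×ˢ Icc e g)) volume) ∧
      ∫ x in a..b, ∫ y in c..d, ∫ z in e..g, f x (c + d - y) z =
        ∫ x in a..b, ∫ y in c..d, ∫ z in e..g, f x y z := by
  refine ⟨?_, ?_⟩
  · have hpre : (reflY3 (c + d) : ℝ × ℝ × ℝ → ℝ × ℝ × ℝ) ⁻¹' (Icc a b ×ˢ (Icc c d ×ˢ Icc e g)) =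
        Icc a b ×ˢ (Icc c d ×ˢ Icc e g) := by
      ext p
      simp only [Set.mem_preimage, Set.mem_prod, Set.mem_Icc, reflY3_apply]
      constructor
      · rintro ⟨h1, ⟨h2, h3⟩, h4⟩; exact ⟨h1, ⟨by linarith, by linarith⟩, h4⟩
      · rintro ⟨h1, ⟨h2, h3⟩, h4⟩; exact ⟨h1, ⟨by linarith, by linarith⟩, h4⟩
    simpa only [reflY3_apply] using
      (setIntegral_comp_equiv3 (measurePreserving_reflY3 (c + d)) (fun p : ℝ × ℝ × ℝ => f p.1 p.2.1 p.2.2) hpre).2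
  · refine intervalIntegral.integral_congr fun x _ => ?_
    have h := intervalIntegral.integral_comp_sub_left (fun y => ∫ z in e..g, f x y z) (c + d) (a := c) (b := d)
    simp only [add_sub_cancel_right, add_sub_cancel_left] at h
    exact h

/-- **Reflection of the box in `z`** (`z ↦ e + g − z`). [cite: DavisRabinowitz1984, Sect. 5.4] -/
theorem integral3_reflect_z (f : ℝ → ℝ → ℝ → ℝ) (a b c d e g : ℝ) :
    (IntegrableOn (fun p : ℝ × ℝ × ℝ => f p.1 p.2.1 (e + g - p.2.2)) (Icc a b ×ˢ (Icc c d ×ˢ Icc e g)) volume ↔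
        IntegrableOn (fun p : ℝ × ℝ × ℝ => f p.1 p.2.1 p.2.2) (Icc a b ×ˢ (Icc c d ×ˢ Icc e g)) volume) ∧
      ∫ x in a..b, ∫ y in c..d, ∫ z in e..g, f x y (e + g - z) =
        ∫ x in a..b, ∫ y in c..d, ∫ z in e..g, f x y z := by
  refine ⟨?_, ?_⟩
  · have hpre : (reflZ3 (e + g) : ℝ × ℝ × ℝ → ℝ × ℝ × ℝ) ⁻¹' (Icc a b ×ˢ (Icc c d ×ˢ Icc e g)) =
        Icc a b ×ˢ (Icc c d ×ˢ Icc e g) := by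
      ext p
      simp only [Set.mem_preimage, Set.mem_prod, Set.mem_Icc, reflZ3_apply]
      constructor
      · rintro ⟨h1, h2, h3, h4⟩; exact ⟨h1, h2, by linarith, by linarith⟩
      · rintro ⟨h1, h2, h3, h4⟩; exact ⟨h1, h2, by linarith, by linarith⟩
    simpa only [reflZ3_apply] using
      (setIntegral_comp_equiv3 (measurePreserving_reflZ3 (e + g)) (fun p : ℝ × ℝ × ℝ => f p.1 p.2.1 p.2.2) hpre).2
  · refine intervalIntegral.integral_congr fun x _ => intervalIntegral.integral_congr fun y _ => ?_
    have h := intervalIntegral.integral_comp_sub_left (fun z => f x y z) (e + g) (a := e) (b := g)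
    simp only [add_sub_cancel_right, add_sub_cancel_left] at h
    exact h

/-- [folklore] The union of two boxes meeting in a null set. -/
private theorem integral_union_box3 {F : ℝ × ℝ × ℝ → ℝ} {B₁ B₂ W : Set (ℝ × ℝ × ℝ)} (hW : B₁ ∩ B₂ ⊆ W)
    (hW0 : volume W = 0) (hB₂ : MeasurableSet B₂) (h₁ : IntegrableOn F B₁ volume)
    (h₂ : IntegrableOn F B₂ volume) :
    IntegrableOn F (B₁ ∪ B₂) volume ∧ ∫ p in B₁ ∪ B₂, F p = (∫ p in B₁, F p) + ∫ p in B₂, F p :=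
  ⟨h₁.union h₂, setIntegral_union₀ (measure_mono_null hW hW0) hB₂.nullMeasurableSet h₁ h₂⟩

/-- **Splitting the box at `x = m`** (compound rules: the box is subdivided into smaller boxes, op. cit.):
integrability on the two halves gives integrability on the whole box and additivity of the iterated integral, so that
a singular line through the interior of a face (or of the box) reduces to edge problems on sub-boxes.
[cite: DavisRabinowitz1984, Sect. 5.8] -/
theorem integral3_split_x {f : ℝ → ℝ → ℝ → ℝ} {a m b c d e g : ℝ} (ham : a ≤ m) (hmb : m ≤ b) (hcd : c ≤ d)
    (heg : e ≤ g)
    (h₁ : IntegrableOn (fun p : ℝ × ℝ × ℝ => f p.1 p.2.1 p.2.2) (Icc a m ×ˢ (Icc c d ×ˢ Icc e g)) volume)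
    (h₂ : IntegrableOn (fun p : ℝ × ℝ × ℝ => f p.1 p.2.1 p.2.2) (Icc m b ×ˢ (Icc c d ×ˢ Icc e g)) volume) :
    IntegrableOn (fun p : ℝ × ℝ × ℝ => f p.1 p.2.1 p.2.2) (Icc a b ×ˢ (Icc c d ×ˢ Icc e g)) volume ∧
      ∫ x in a..b, ∫ y in c..d, ∫ z in e..g, f x y z =
        (∫ x in a..m, ∫ y in c..d, ∫ z in e..g, f x y z) + ∫ x in m..b, ∫ y in c..d, ∫ z in e..g, f x y z := by
  have hU : (Icc a b ×ˢ (Icc c d ×ˢ Icc e g) : Set (ℝ × ℝ × ℝ)) =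
      Icc a m ×ˢ (Icc c d ×ˢ Icc e g) ∪ Icc m b ×ˢ (Icc c d ×ˢ Icc e g) := by
    rw [← Set.union_prod, Icc_union_Icc_eq_Icc ham hmb]
  have hW : Icc a m ×ˢ (Icc c d ×ˢ Icc e g) ∩ Icc m b ×ˢ (Icc c d ×ˢ Icc e g) ⊆
      (({m} : Set ℝ) ×ˢ (Icc c d ×ˢ Icc e g) : Set (ℝ × ℝ × ℝ)) := by
    rintro p ⟨⟨⟨-, h2⟩, h3⟩, ⟨⟨h4, -⟩, -⟩⟩
    exact ⟨le_antisymm h2 h4, h3⟩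
  have hW0 : volume (({m} : Set ℝ) ×ˢ (Icc c d ×ˢ Icc e g) : Set (ℝ × ℝ × ℝ)) = 0 := by
    rw [Measure.volume_eq_prod, Measure.prod_prod, measure_singleton, zero_mul]
  obtain ⟨hI, hE⟩ := integral_union_box3 hW hW0
    (measurableSet_Icc.prod (measurableSet_Icc.prod measurableSet_Icc)) h₁ h₂
  rw [← hU] at hI hE
  refine ⟨hI, ?_⟩
  rw [intervalIntegral_iterated3_eq_setIntegral_prod (ham.trans hmb) hcd heg hI,
    intervalIntegral_iterated3_eq_setIntegral_prod ham hcd heg h₁,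
    intervalIntegral_iterated3_eq_setIntegral_prod hmb hcd heg h₂, hE]

/-- **Splitting the box at `y = m`**. [cite: DavisRabinowitz1984, Sect. 5.8] -/
theorem integral3_split_y {f : ℝ → ℝ → ℝ → ℝ} {a b c m d e g : ℝ} (hab : a ≤ b) (hcm : c ≤ m) (hmd : m ≤ d)
    (heg : e ≤ g)
    (h₁ : IntegrableOn (fun p : ℝ × ℝ × ℝ => f p.1 p.2.1 p.2.2) (Icc a b ×ˢ (Icc c m ×ˢ Icc e g)) volume)
    (h₂ : IntegrableOn (fun p : ℝ × ℝ × ℝ => f p.1 p.2.1 p.2.2) (Icc a b ×ˢ (Icc m d ×ˢ Icc e g)) volume) :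
    IntegrableOn (fun p : ℝ × ℝ × ℝ => f p.1 p.2.1 p.2.2) (Icc a b ×ˢ (Icc c d ×ˢ Icc e g)) volume ∧
      ∫ x in a..b, ∫ y in c..d, ∫ z in e..g, f x y z =
        (∫ x in a..b, ∫ y in c..m, ∫ z in e..g, f x y z) + ∫ x in a..b, ∫ y in m..d, ∫ z in e..g, f x y z := by
  have hU : (Icc a b ×ˢ (Icc c d ×ˢ Icc e g) : Set (ℝ × ℝ × ℝ)) =
      Icc a b ×ˢ (Icc c m ×ˢ Icc e g) ∪ Icc a b ×ˢ (Icc m d ×ˢ Icc e g) := by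
    rw [← Set.prod_union, ← Set.union_prod, Icc_union_Icc_eq_Icc hcm hmd]
  have hW : Icc a b ×ˢ (Icc c m ×ˢ Icc e g) ∩ Icc a b ×ˢ (Icc m d ×ˢ Icc e g) ⊆
      (Icc a b ×ˢ (({m} : Set ℝ) ×ˢ Icc e g) : Set (ℝ × ℝ × ℝ)) := by
    rintro p ⟨⟨h1, ⟨-, h3⟩, h4⟩, ⟨-, ⟨h6, -⟩, -⟩⟩
    exact ⟨h1, le_antisymm h3 h6, h4⟩
  have hW0 : volume (Icc a b ×ˢ (({m} : Set ℝ) ×ˢ Icc e g) : Set (ℝ × ℝ × ℝ)) = 0 := by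
    rw [Measure.volume_eq_prod, Measure.prod_prod, Measure.volume_eq_prod, Measure.prod_prod, measure_singleton,
      zero_mul, mul_zero]
  obtain ⟨hI, hE⟩ := integral_union_box3 hW hW0
    (measurableSet_Icc.prod (measurableSet_Icc.prod measurableSet_Icc)) h₁ h₂
  rw [← hU] at hI hE
  refine ⟨hI, ?_⟩
  rw [intervalIntegral_iterated3_eq_setIntegral_prod hab (hcm.trans hmd) heg hI,
    intervalIntegral_iterated3_eq_setIntegral_prod hab hcm heg h₁,
    intervalIntegral_iterated3_eq_setIntegral_prod hab hmd heg h₂, hE]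

/-- **Splitting the box at `z = m`**. [cite: DavisRabinowitz1984, Sect. 5.8] -/
theorem integral3_split_z {f : ℝ → ℝ → ℝ → ℝ} {a b c d e m g : ℝ} (hab : a ≤ b) (hcd : c ≤ d) (hem : e ≤ m)
    (hmg : m ≤ g)
    (h₁ : IntegrableOn (fun p : ℝ × ℝ × ℝ => f p.1 p.2.1 p.2.2) (Icc a b ×ˢ (Icc c d ×ˢ Icc e m)) volume)
    (h₂ : IntegrableOn (fun p : ℝ × ℝ × ℝ => f p.1 p.2.1 p.2.2) (Icc a b ×ˢ (Icc c d ×ˢ Icc m g)) volume) :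
    IntegrableOn (fun p : ℝ × ℝ × ℝ => f p.1 p.2.1 p.2.2) (Icc a b ×ˢ (Icc c d ×ˢ Icc e g)) volume ∧
      ∫ x in a..b, ∫ y in c..d, ∫ z in e..g, f x y z =
        (∫ x in a..b, ∫ y in c..d, ∫ z in e..m, f x y z) + ∫ x in a..b, ∫ y in c..d, ∫ z in m..g, f x y z := by
  have hU : (Icc a b ×ˢ (Icc c d ×ˢ Icc e g) : Set (ℝ × ℝ × ℝ)) =
      Icc a b ×ˢ (Icc c d ×ˢ Icc e m) ∪ Icc a b ×ˢ (Icc c d ×ˢ Icc m g) := by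
    rw [← Set.prod_union, ← Set.prod_union, Icc_union_Icc_eq_Icc hem hmg]
  have hW : Icc a b ×ˢ (Icc c d ×ˢ Icc e m) ∩ Icc a b ×ˢ (Icc c d ×ˢ Icc m g) ⊆
      (Icc a b ×ˢ (Icc c d ×ˢ ({m} : Set ℝ)) : Set (ℝ × ℝ × ℝ)) := by
    rintro p ⟨⟨h1, h2, ⟨-, h3⟩⟩, ⟨-, -, ⟨h6, -⟩⟩⟩
    exact ⟨h1, h2, le_antisymm h3 h6⟩
  have hW0 : volume (Icc a b ×ˢ (Icc c d ×ˢ ({m} : Set ℝ)) : Set (ℝ × ℝ × ℝ)) = 0 := by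
    rw [Measure.volume_eq_prod, Measure.prod_prod, Measure.volume_eq_prod, Measure.prod_prod, measure_singleton,
      mul_zero, mul_zero]
  obtain ⟨hI, hE⟩ := integral_union_box3 hW hW0
    (measurableSet_Icc.prod (measurableSet_Icc.prod measurableSet_Icc)) h₁ h₂
  rw [← hU] at hI hE
  refine ⟨hI, ?_⟩
  rw [intervalIntegral_iterated3_eq_setIntegral_prod hab hcd (hem.trans hmg) hI,
    intervalIntegral_iterated3_eq_setIntegral_prod hab hcd hem h₁,
    intervalIntegral_iterated3_eq_setIntegral_prod hab hcd hmg h₂, hE]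

end PolyMP

end Literature.Analysis.ValidatedNumerics
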